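import Summits.NavierStokesRegularity.NavierStokesRegularity.Theses.RellichScar
import Summits.NavierStokesRegularity.NavierStokesRegularity.Theorems.SymmetricScarExists.Negative.SpiralWorld
import Summits.NavierStokesRegularity.NavierStokesRegularity.Theorems.RellichScarScarRigidityApexMild
import Summits.NavierStokesRegularity.NavierStokesRegularity.Theorems.RellichScarScarRigidityApexBounds
import Summits.NavierStokesRegularity.NavierStokesRegularity.Theorems.RellichScarSymmetricScarExistsScarDefectLimit
import Summits.NavierStokesRegularity.NavierStokesRegularity.Theorems.RellichScarSymmetricScarExistsSmallConstant
import Literature.Analysis.FluidPDE.ChaeWolfRemovingDSSProofs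
import Literature.Analysis.FluidPDE.LocalTypeI
import Literature.Analysis.FluidPDE.TypeIAncientMild

/-!
# Crux `SymmetricScarExists` (stmt-NavierStokesRegularity-11718): no `λ`-DSS singular apex profile for `λ` near `1`

Helper file of the line lead (`--supports stmt-NavierStokesRegularity-11718`; theorems only, no definitions, no
named facts).  The route's planner foresaw a WIDENING of the crux's dichotomy "(−1)-homogeneous scar ∨ axisymmetric
scar" by a third alternative "λ-DSS scar with `λ < λ_*(C)`", to be killed by Chae–Wolf 2017, Thm 1.3
(`Theses/RellichScar.lean`, TWO-LAYER PLAN).  This file lands that kill in the apex class — the Fatal support the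
widened crux would need, and one more emptiness certificate for the crux's antecedent:

* `dssApexFatal_nearOne` (registered auxiliary stub): for every `C > 0` there is `c₁ > 1` (Chae–Wolf's `λ_*(C)`) such
  that for `1 < c < c₁` NO suitable weak solution on the slab with a weak gradient, `𝐈 < ∞` and the apex bound of
  constant `C`, singular at the origin, is a.e. `c`-discretely self-similar (`c u(c²t, cx) = u(t, x)` a.e. on the
  slab).  Proof: the profile is a.e. a Type-I ancient mild field `V` (KNSS Lemma 3.1 + Prop. 4.1,
  `stub_apexMildRepresentative`), classical on `(−∞,0)` for some smooth pressure
  (`exists_isClassicalNSSolutionOn_Iio`, Fabes–Jones–Rivière); the a.e. self-similarity transports to `V`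
  (`nsRescale_ae_eq_slab`) and, both sides being continuous on the open slab, holds there pointwise
  (`Measure.eqOn_open_of_ae_eq`); truncating `V` to `0` for `t ≥ 0` gives an everywhere `c`-DSS classical
  solution with the Type-I bound, which vanishes by Chae–Wolf 2017 Thm 1.3 (tree: `chaeWolf2017_removing_dss_holds`);
  so `u = 0` a.e. on the slab and the origin is not singular (`not_isBackwardSingularPoint_of_ae_zero_slab`).

References: D. Chae, J. Wolf, *Removing discretely self-similar singularities for the 3D Navier–Stokes equations*,
Comm. PDE 42 (2017) = arXiv:1610.09464, Thm 1.3 p. 3 [ChaeWolf2017RemovingDSS]; G. Koch, N. Nadirashvili,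
G. Seregin, V. Šverák, Acta Math. 203 (2009), Lemma 3.1, Prop. 4.1 [KNSS2009]; E. Fabes, B. Jones, N. Rivière,
ARMA 45 (1972), Thm 2.1 [FabesJonesRiviere1972].
-/

noncomputable section

open MeasureTheory Set Function Filter Topology TopologicalSpace Metric
open scoped NNReal ENNReal

namespace Summit.NavierStokesRegularity.NavierStokesRegularity.Theorems.SymmetricScarExists.ScarWindow

open Literature.Analysis.FluidPDE
open Summit.NavierStokesRegularity.NavierStokesRegularity.Theses.RellichScar
open Summit.NavierStokesRegularity.NavierStokesRegularity.Theorems.SymmetricScarExists.Negative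
open Summit.NavierStokesRegularity.NavierStokesRegularity.Theorems.RellichScarScarRigidity
  (stub_apexMildRepresentative exists_isClassicalNSSolutionOn_Iio)

set_option linter.dupNamespace false

/-- **Truncation to the past keeps a classical solution on `(−∞, 0)` classical**: replacing the velocity by `0`
for `t ≥ 0` does not change smoothness on `Iio 0 ×ˢ univ`, the one-sided time derivative within `Iio 0`, or the
slices at negative times. [folklore] -/
theorem isClassicalNSSolutionOn_truncate {V : ℝ → EuclideanSpace ℝ (Fin 3) → EuclideanSpace ℝ (Fin 3)}
    {Q : ℝ → EuclideanSpace ℝ (Fin 3) → ℝ} (hcl : IsClassicalNSSolutionOn (Iio (0 : ℝ)) 1 0 V Q) :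
    IsClassicalNSSolutionOn (Iio (0 : ℝ)) 1 0 (fun t x => if t < 0 then V t x else 0) Q := by
  have hslice : ∀ t : ℝ, t < 0 → (fun x => if t < 0 then V t x else (0 : EuclideanSpace ℝ (Fin 3))) = V t :=
    fun t ht => funext fun x => if_pos ht
  refine ⟨?_, hcl.smooth_pressure, fun t ht x => ?_, fun t ht => ?_⟩
  · -- smoothness on the open slab: the truncation agrees with `V` there
    refine (hcl.smooth_velocity).congr ?_
    rintro ⟨t, x⟩ ⟨ht, -⟩
    simp only [uncurry_apply_pair, if_pos (show t < 0 from ht)]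
  · -- momentum at `t < 0`: every term is computed from values at negative times
    have hm := hcl.momentum t ht x
    have hder : timeDerivWithin (Iio (0 : ℝ)) (fun s y => if s < 0 then V s y else 0) t x =
        timeDerivWithin (Iio (0 : ℝ)) V t x := by
      simp only [timeDerivWithin_apply]
      exact derivWithin_congr (fun s hs => by simp only [if_pos (show s < 0 from hs)])
        (by simp only [if_pos (show t < 0 from ht)])
    rw [hder, hslice t ht]
    exact hm
  · rw [hslice t ht]
    exact hcl.divFree t ht

/-- **No `λ`-DSS singular apex profile for `λ` close to `1`** (registered auxiliary stub `dssApexFatal_nearOne` of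
crux stmt-NavierStokesRegularity-11718; Chae–Wolf 2017 Thm 1.3 in the apex class).  For every `C > 0` there is
`c₁ > 1` such that for `1 < c < c₁` no suitable weak solution on the slab with a weak gradient, `𝐈 < ∞` and the apex
bound `‖u‖ ≤ C/(‖x‖ + √(−t))`, singular at the origin, satisfies `c u(c²t, cx) = u(t,x)` a.e. on the slab.
[cite: ChaeWolf2017RemovingDSS, Theorem 1.3 (arXiv:1610.09464 p. 3)] -/
theorem dssApexFatal_nearOne :
    ∀ C : ℝ, 0 < C → ∃ c₁ : ℝ, 1 < c₁ ∧ ∀ c : ℝ, 1 < c → c < c₁ →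
      ∀ (u : ℝ → EuclideanSpace ℝ (Fin 3) → EuclideanSpace ℝ (Fin 3)) (p : ℝ → EuclideanSpace ℝ (Fin 3) → ℝ) (G : ℝ → EuclideanSpace ℝ (Fin 3) → EuclideanSpace ℝ (Fin 3) →L[ℝ] EuclideanSpace ℝ (Fin 3)),
        IsSuitableWeakSolutionOn (slab (EuclideanSpace ℝ (Fin 3)) (Iio (0 : ℝ)) isOpen_Iio) 1 0 u p → HasWeakSpatialGradientOn (slab (EuclideanSpace ℝ (Fin 3)) (Iio (0 : ℝ)) isOpen_Iio) u G → typeIBound (Iio (0 : ℝ) ×ˢ univ) u p G < ⊤ → HasTypeIDecay C u → IsBackwardSingularPoint u 0 →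
        uncurry (nsRescale c u) =ᵐ[volume.restrict (Iio (0 : ℝ) ×ˢ (univ : Set (EuclideanSpace ℝ (Fin 3))))] uncurry u → False := by
  intro C hC
  obtain ⟨c₁, hc₁, hcw⟩ := chaeWolf2017_removing_dss_holds C hC
  refine ⟨c₁, hc₁, fun c h1 h2 u p G hsw hwg hI hdec hsing hdss => ?_⟩
  have hc0 : 0 < c := one_pos.trans h1
  -- the Type-I ancient mild representative and a classical pressure
  obtain ⟨V, hae, hmild, hdecV⟩ := stub_apexMildRepresentative u p G C hC hsw hwg hI hdec
  obtain ⟨Q, hcl⟩ := exists_isClassicalNSSolutionOn_Iio hmild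
  -- the a.e. self-similarity transports to `V` and holds pointwise on the open slab
  have hcontV : ContinuousOn (uncurry V) (Iio (0 : ℝ) ×ˢ (univ : Set (EuclideanSpace ℝ (Fin 3)))) :=
    hmild.1.continuousOn
  have haeV : uncurry (nsRescale c V)
      =ᵐ[volume.restrict (Iio (0 : ℝ) ×ˢ (univ : Set (EuclideanSpace ℝ (Fin 3))))] uncurry V :=
    ((nsRescale_ae_eq_slab hc0 hae).trans hdss).trans hae.symm
  have heqOn : EqOn (uncurry (nsRescale c V)) (uncurry V) (Iio (0 : ℝ) ×ˢ (univ : Set (EuclideanSpace ℝ (Fin 3)))) :=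
    Measure.eqOn_open_of_ae_eq haeV (isOpen_Iio.prod isOpen_univ) (continuousOn_uncurry_nsRescale hc0 hcontV) hcontV
  have hVdss : ∀ t : ℝ, t < 0 → ∀ x : EuclideanSpace ℝ (Fin 3), nsRescale c V t x = V t x :=
    fun t ht x => heqOn (mk_mem_prod ht (mem_univ x))
  -- truncate to the past: an everywhere `c`-DSS classical solution with the Type-I bound
  set V' : ℝ → EuclideanSpace ℝ (Fin 3) → EuclideanSpace ℝ (Fin 3) := fun t x => if t < 0 then V t x else 0 with hV'
  have hc2 : 0 < c ^ 2 := by positivity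
  have hdssV' : IsDiscretelySelfSimilar c V' := by
    funext t x
    by_cases ht : t < 0
    · have hct : c ^ 2 * t < 0 := mul_neg_of_pos_of_neg hc2 ht
      have h := hVdss t ht x
      rw [nsRescale_apply] at h ⊢
      simp only [hV', if_pos hct, if_pos ht]
      exact h
    · have hct : ¬ c ^ 2 * t < 0 := fun h' => ht (by nlinarith)
      rw [nsRescale_apply]
      simp only [hV', if_neg hct, if_neg ht, smul_zero]
  have hclV' : IsClassicalNSSolutionOn (Iio (0 : ℝ)) 1 0 V' Q := isClassicalNSSolutionOn_truncate hcl
  have hdecV' : HasTypeIDecay C V' := fun t ht x => by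
    simp only [hV', if_pos ht]
    exact hdecV t ht x
  have hzero : ∀ t < (0 : ℝ), ∀ x, V' t x = 0 := hcw c h1 h2 V' Q hclV' hdssV' hdecV'
  -- hence `u = 0` a.e. on the slab, and the origin is not singular
  refine not_isBackwardSingularPoint_of_ae_zero_slab (u := u) ?_ hsing
  filter_upwards [hae, ae_restrict_mem (measurableSet_Iio.prod MeasurableSet.univ)] with w hw hmem
  have h0 := hzero w.1 hmem.1 w.2
  simp only [hV', if_pos (show w.1 < 0 from hmem.1)] at h0
  rw [← hw]
  exact h0

end Summit.NavierStokesRegularity.NavierStokesRegularity.Theorems.SymmetricScarExists.ScarWindow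

end
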